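import Literature.Probability.LatticeModels.RescaledUrsellUniformOnCompact
import Literature.Probability.LatticeModels.CriticalUrsellFourSign
import Literature.Probability.LatticeModels.CriticalBlockMoments

/-!
# Summit descent for `LeeYangGap` (1/3): the numerator `3Σ_L² - ⟨M_L⁴⟩` under a non-Gaussian limit

Route `LeeYangGap` (CriticalPhenomena / Ising3DConformalLimit), crux `NearCriticalLeeYangGap`
(stmt-CriticalPhenomena-4945), redirect strategist r1.  Part 1 of the kernel-checked descent
`Ising3DConformalLimit → NearCriticalLeeYangGap` (assembled in `LeeYangGapSummitDescent.lean`).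

`numerator_lower`: if `criticalCorr 3` has a pointwise scaling limit `S` with renormalisation `ρ > 0` on
`(0,1]`, scale covariance of dimension `Δ` and `U₄^S ≢ 0`, then for all large `L`
`ρ(1/L)⁴ Σ_{a,b,c,e ∈ Λ_L} (-U₄^{lat}(a,b,c,e)) ≥ c L¹²` with `c > 0`, where
`U₄^{lat} = ⟨σσσσ⟩_{β_c} - Σ_{pairings}⟨σσ⟩_{β_c}⟨σσ⟩_{β_c}` is the lattice Ursell function (written out).

Proof sketch: a strictly negative value `U₄^S(x₁) < 0` inside the unit cube (Lebowitz sign + scale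
covariance); the ONE-SIDED CELL TRICK `floor_div_eq_of_corner` (the floor function is right-continuous, so at
any mesh the rescaled lattice Ursell function is constant on a one-sided corner box
`{y | x_{jk} ≤ y_{jk} ≤ x_{jk} + r}` — no continuity of `S` is needed); uniform convergence on a compact
corner box (`tendstoUniformlyOn_rescaled_criticalUrsellFour`); counting the `≳ (r₁L/2)¹²` lattice
quadruples of `Λ_L⁴` in the box at mesh `1/L`; Lebowitz (`criticalUrsellFour_nonpos`) for all other
terms.  Details in the module docstring of Part 3.

## References

* M. Aizenman, Comm. Math. Phys. 86 (1982), §1, Prop. 5.3 (sign of `U₄`, block criterion) [Aizenman1982].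
* C. M. Newman, Comm. Math. Phys. 41 (1975), Thm 3 and (6) [Newman1975].
-/

noncomputable section

namespace Summit.CriticalPhenomena.Ising3DConformalLimit.LeeYangGapSummitDescent

open Literature.Probability.LatticeModels Filter Set Finset
open scoped Topology BigOperators

/-- Floor is right-continuous: for `δ > 0`, `⌊y/δ⌋ = ⌊w/δ⌋` whenever
`w ≤ y < w + δ (1 - fract(w/δ))`. -/
theorem floor_div_eq_of_corner {δ w y : ℝ} (hδ : 0 < δ) (hwy : w ≤ y)
    (hy : y < w + δ * (1 - Int.fract (w / δ))) : ⌊y / δ⌋ = ⌊w / δ⌋ := by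
  rw [Int.floor_eq_iff]
  refine ⟨(Int.floor_le _).trans (div_le_div_of_nonneg_right hwy hδ.le), ?_⟩
  have h1 : y / δ < w / δ + (1 - Int.fract (w / δ)) := by
    rw [div_lt_iff₀ hδ, add_mul, div_mul_cancel₀ w hδ.ne']
    linarith
  have h2 : w / δ - Int.fract (w / δ) = ⌊w / δ⌋ := Int.self_sub_fract (w / δ)
  linarith

/-- `U₄^S(c x) = c^{-4Δ} U₄^S(x)` for a scale-covariant family. -/
theorem limitConnectedFour_smul {Δ : ℝ} {S : CorrFamily 3} (hsc : IsScaleCovariant Δ S) {c : ℝ}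
    (hc : 0 < c) (x : Fin 4 → EuclideanSpace ℝ (Fin 3)) :
    limitConnectedFour S (fun j => c • x j) = c ^ (-(4:ℝ) * Δ) * limitConnectedFour S x := by
  have h4 : S 4 (fun j => c • x j) = c ^ (-(4:ℝ) * Δ) * S 4 x := by
    have h := hsc 4 c hc x
    rw [show ((4 : ℕ) : ℝ) = 4 by norm_num] at h
    exact h
  have h2 : ∀ i j : Fin 4, S 2 ![c • x i, c • x j] = c ^ (-(2:ℝ) * Δ) * S 2 ![x i, x j] := by
    intro i j
    have e : (![c • x i, c • x j] : Fin 2 → EuclideanSpace ℝ (Fin 3)) =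
        fun k => c • (![x i, x j] : Fin 2 → EuclideanSpace ℝ (Fin 3)) k := by
      funext k; fin_cases k <;> rfl
    have h := hsc 2 c hc ![x i, x j]
    rw [show ((2 : ℕ) : ℝ) = 2 by norm_num] at h
    rw [e, h]
  have hcc : c ^ (-(2:ℝ) * Δ) * c ^ (-(2:ℝ) * Δ) = c ^ (-(4:ℝ) * Δ) := by
    rw [← Real.rpow_add hc]; ring_nf
  simp only [limitConnectedFour]
  rw [h4, h2 0 1, h2 2 3, h2 0 2, h2 1 3, h2 0 3, h2 1 2, ← hcc]
  ring

/-- The closed one-sided corner box `{y | x_{jk} ≤ y_{jk} ≤ x_{jk} + r}` at a configuration `x` is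
compact (a product of images of compact coordinate boxes). -/
theorem isCompact_corner (x : Fin 4 → EuclideanSpace ℝ (Fin 3)) (r : ℝ) :
    IsCompact {y : Fin 4 → EuclideanSpace ℝ (Fin 3) | ∀ j k, x j k ≤ y j k ∧ y j k ≤ x j k + r} := by
  have e : {y : Fin 4 → EuclideanSpace ℝ (Fin 3) | ∀ j k, x j k ≤ y j k ∧ y j k ≤ x j k + r} =
      Set.pi Set.univ (fun j => (WithLp.toLp 2) '' Set.Icc (fun k => x j k) (fun k => x j k + r)) := by
    ext y
    simp only [Set.mem_setOf_eq, Set.mem_univ_pi, Set.mem_image, Set.mem_Icc]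
    constructor
    · intro h j
      exact ⟨fun k => y j k, ⟨fun k => (h j k).1, fun k => (h j k).2⟩, rfl⟩
    · intro h j k
      obtain ⟨f, ⟨hf1, hf2⟩, hfy⟩ := h j
      have hyk : y j k = f k := by rw [← hfy]
      rw [hyk]
      exact ⟨hf1 k, hf2 k⟩
  rw [e]
  exact isCompact_univ_pi fun j => isCompact_Icc.image (PiLp.continuous_toLp 2 _)

/-- A small corner box at a non-coincident configuration is non-coincident. -/
theorem exists_corner_subset_nonCoincident {x : Fin 4 → EuclideanSpace ℝ (Fin 3)}
    (hx : x ∈ NonCoincident 3 4) :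
    ∃ r : ℝ, 0 < r ∧ r ≤ 1 / 2 ∧
      {y : Fin 4 → EuclideanSpace ℝ (Fin 3) | ∀ j k, x j k ≤ y j k ∧ y j k ≤ x j k + r} ⊆
        NonCoincident 3 4 := by
  have hinj : Function.Injective x := hx
  have hsep : ∀ i j : Fin 4, i ≠ j → ∃ k, x i k ≠ x j k := by
    intro i j hij
    by_contra h
    push Not at h
    exact hij (hinj (PiLp.ext h))
  have hev : ∀ᶠ r in 𝓝[>] (0:ℝ), ∀ i j : Fin 4, i ≠ j → ∀ y : Fin 4 → EuclideanSpace ℝ (Fin 3),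
      (∀ j k, x j k ≤ y j k ∧ y j k ≤ x j k + r) → y i ≠ y j := by
    refine Filter.eventually_all.2 fun i => Filter.eventually_all.2 fun j => ?_
    by_cases hij : i = j
    · exact Filter.Eventually.of_forall fun r h => absurd hij h
    obtain ⟨k, hk⟩ := hsep i j hij
    have hpos : 0 < |x i k - x j k| := abs_pos.2 (sub_ne_zero.2 hk)
    have hI : Set.Iio |x i k - x j k| ∈ 𝓝[>] (0:ℝ) :=
      mem_nhdsWithin_of_mem_nhds (Iio_mem_nhds hpos)
    filter_upwards [hI] with r hr _ y hy hyij
    have h1 := hy i k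
    have h2 := hy j k
    have h3 : y i k = y j k := by rw [hyij]
    rw [Set.mem_Iio] at hr
    have h4 : |x i k - x j k| ≤ r := by
      rw [abs_le]; constructor <;> linarith [h1.1, h1.2, h2.1, h2.2]
    linarith
  have hhalf : ∀ᶠ r in 𝓝[>] (0:ℝ), r ≤ 1 / 2 :=
    mem_nhdsWithin_of_mem_nhds (Iic_mem_nhds (by norm_num))
  obtain ⟨r, ⟨hr1, hr2⟩, hr0⟩ := ((hev.and hhalf).and self_mem_nhdsWithin).exists
  refine ⟨r, hr0, hr2, fun y hy => ?_⟩
  rw [mem_nonCoincident]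
  intro i j hyij
  by_contra hij
  exact hr1 i j hij y hy hyij

/-- The mesh `δ = 1/L` tends to `0⁺` along `L → ∞`. -/
theorem tendsto_one_div_nat : Tendsto (fun L : ℕ => 1 / (L : ℝ)) atTop (𝓝[>] (0 : ℝ)) := by
  rw [tendsto_nhdsWithin_iff]
  refine ⟨tendsto_one_div_atTop_nhds_zero_nat, ?_⟩
  filter_upwards [eventually_ge_atTop 1] with L hL
  have : (0 : ℝ) < L := by exact_mod_cast hL
  exact Set.mem_Ioi.2 (by positivity)

/-- Restricting a fourfold sum of non-negative terms to a product of subsets. -/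
theorem sum4_le_sum4 {f : Site 3 → Site 3 → Site 3 → Site 3 → ℝ} (hf : ∀ a b c e, 0 ≤ f a b c e)
    {B A₀ A₁ A₂ A₃ : Finset (Site 3)} (h₀ : A₀ ⊆ B) (h₁ : A₁ ⊆ B) (h₂ : A₂ ⊆ B) (h₃ : A₃ ⊆ B) :
    ∑ a ∈ A₀, ∑ b ∈ A₁, ∑ c ∈ A₂, ∑ e ∈ A₃, f a b c e ≤
      ∑ a ∈ B, ∑ b ∈ B, ∑ c ∈ B, ∑ e ∈ B, f a b c e := by
  calc ∑ a ∈ A₀, ∑ b ∈ A₁, ∑ c ∈ A₂, ∑ e ∈ A₃, f a b c e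
      ≤ ∑ a ∈ A₀, ∑ b ∈ A₁, ∑ c ∈ A₂, ∑ e ∈ B, f a b c e :=
        Finset.sum_le_sum fun a _ => Finset.sum_le_sum fun b _ => Finset.sum_le_sum fun c _ =>
          Finset.sum_le_sum_of_subset_of_nonneg h₃ fun e _ _ => hf a b c e
    _ ≤ ∑ a ∈ A₀, ∑ b ∈ A₁, ∑ c ∈ B, ∑ e ∈ B, f a b c e :=
        Finset.sum_le_sum fun a _ => Finset.sum_le_sum fun b _ =>
          Finset.sum_le_sum_of_subset_of_nonneg h₂ fun c _ _ =>
            Finset.sum_nonneg fun e _ => hf a b c e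
    _ ≤ ∑ a ∈ A₀, ∑ b ∈ B, ∑ c ∈ B, ∑ e ∈ B, f a b c e :=
        Finset.sum_le_sum fun a _ =>
          Finset.sum_le_sum_of_subset_of_nonneg h₁ fun b _ _ =>
            Finset.sum_nonneg fun c _ => Finset.sum_nonneg fun e _ => hf a b c e
    _ ≤ ∑ a ∈ B, ∑ b ∈ B, ∑ c ∈ B, ∑ e ∈ B, f a b c e :=
        Finset.sum_le_sum_of_subset_of_nonneg h₀ fun a _ _ =>
          Finset.sum_nonneg fun b _ => Finset.sum_nonneg fun c _ =>
            Finset.sum_nonneg fun e _ => hf a b c e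

/-- `(L r - 1)³ ≤ |Π_k [⌈L u_k⌉, ⌊L (u_k + r)⌋]|` when `L r ≥ 1` (the integer box of lattice points `z`
with `z/L` in the corner cube of side `r` at `u`). -/
theorem le_card_latticeCube {L : ℕ} {u : EuclideanSpace ℝ (Fin 3)} {r : ℝ} (hLr : 1 ≤ (L : ℝ) * r) :
    ((L : ℝ) * r - 1) ^ 3 ≤
      (#(Fintype.piFinset fun k => Finset.Icc ⌈(L : ℝ) * u k⌉ ⌊(L : ℝ) * (u k + r)⌋) : ℝ) := by
  have hk : ∀ k : Fin 3,
      (L : ℝ) * r - 1 ≤ (#(Finset.Icc ⌈(L : ℝ) * u k⌉ ⌊(L : ℝ) * (u k + r)⌋) : ℝ) := by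
    intro k
    rw [Int.card_Icc]
    have h1 : ((⌊(L : ℝ) * (u k + r)⌋ + 1 - ⌈(L : ℝ) * u k⌉ : ℤ) : ℝ) ≤
        ((⌊(L : ℝ) * (u k + r)⌋ + 1 - ⌈(L : ℝ) * u k⌉).toNat : ℝ) := by
      exact_mod_cast Int.self_le_toNat _
    have h2 : (L : ℝ) * (u k + r) < ⌊(L : ℝ) * (u k + r)⌋ + 1 := Int.lt_floor_add_one _
    have h3 : (⌈(L : ℝ) * u k⌉ : ℝ) < (L : ℝ) * u k + 1 := Int.ceil_lt_add_one _
    push_cast at h1 ⊢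
    linarith
  have hnn : 0 ≤ (L : ℝ) * r - 1 := by linarith
  calc ((L : ℝ) * r - 1) ^ 3 = ∏ _k : Fin 3, ((L : ℝ) * r - 1) := by simp
    _ ≤ ∏ k : Fin 3, (#(Finset.Icc ⌈(L : ℝ) * u k⌉ ⌊(L : ℝ) * (u k + r)⌋) : ℝ) :=
        Finset.prod_le_prod (fun k _ => hnn) fun k _ => hk k
    _ = (#(Fintype.piFinset fun k => Finset.Icc ⌈(L : ℝ) * u k⌉ ⌊(L : ℝ) * (u k + r)⌋) : ℝ) := by
        rw [Fintype.card_piFinset]; push_cast; rfl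

/-- Lattice points of the integer box lie in `Λ_L` when `|u_k| ≤ 1/2` and `r ≤ 1/2`. -/
theorem latticeCube_subset_box {L : ℕ} {u : EuclideanSpace ℝ (Fin 3)} {r : ℝ}
    (hu : ∀ k, |u k| ≤ 1 / 2) (hr : r ≤ 1 / 2) :
    (Fintype.piFinset fun k => Finset.Icc ⌈(L : ℝ) * u k⌉ ⌊(L : ℝ) * (u k + r)⌋) ⊆ box 3 L := by
  intro z hz
  rw [mem_box]
  intro k
  obtain ⟨h1, h2⟩ := Finset.mem_Icc.1 (Fintype.mem_piFinset.1 hz k)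
  have hL : (0 : ℝ) ≤ L := Nat.cast_nonneg L
  have huk := abs_le.1 (hu k)
  have h1' : ((⌈(L : ℝ) * u k⌉ : ℤ) : ℝ) ≤ z k := by exact_mod_cast h1
  have h2' : ((z k : ℤ) : ℝ) ≤ ⌊(L : ℝ) * (u k + r)⌋ := by exact_mod_cast h2
  have h3 : (L : ℝ) * u k ≤ ⌈(L : ℝ) * u k⌉ := Int.le_ceil _
  have h4 : (⌊(L : ℝ) * (u k + r)⌋ : ℝ) ≤ (L : ℝ) * (u k + r) := Int.floor_le _
  have hlo : -(L : ℝ) ≤ z k := by nlinarith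
  have hhi : (z k : ℝ) ≤ L := by nlinarith
  constructor
  · exact_mod_cast hlo
  · exact_mod_cast hhi

/-- Rescaled lattice points of the integer box lie in the corner cube: `u_k ≤ z_k/L ≤ u_k + r`. -/
theorem div_mem_of_mem_latticeCube {L : ℕ} (hL : 0 < L) {u : EuclideanSpace ℝ (Fin 3)} {r : ℝ}
    {z : Site 3} (hz : z ∈ Fintype.piFinset fun k => Finset.Icc ⌈(L : ℝ) * u k⌉ ⌊(L : ℝ) * (u k + r)⌋)
    (k : Fin 3) :
    u k ≤ ((1 / (L : ℝ)) • siteVec z) k ∧ ((1 / (L : ℝ)) • siteVec z) k ≤ u k + r := by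
  obtain ⟨h1, h2⟩ := Finset.mem_Icc.1 (Fintype.mem_piFinset.1 hz k)
  have hLr : (0 : ℝ) < L := by exact_mod_cast hL
  have h1' : ((⌈(L : ℝ) * u k⌉ : ℤ) : ℝ) ≤ z k := by exact_mod_cast h1
  have h2' : ((z k : ℤ) : ℝ) ≤ ⌊(L : ℝ) * (u k + r)⌋ := by exact_mod_cast h2
  have h3 : (L : ℝ) * u k ≤ ⌈(L : ℝ) * u k⌉ := Int.le_ceil _
  have h4 : (⌊(L : ℝ) * (u k + r)⌋ : ℝ) ≤ (L : ℝ) * (u k + r) := Int.floor_le _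
  rw [PiLp.smul_apply, siteVec_apply, smul_eq_mul, one_div, inv_mul_eq_div]
  constructor
  · rw [le_div_iff₀ hLr]; linarith
  · rw [div_le_iff₀ hLr]; linarith

/-- **Numerator lower bound.** Under a pointwise scaling limit with `ρ > 0` on `(0,1]`, scale
covariance and `U₄^S ≢ 0`: `ρ(1/L)⁴ Σ_{Λ_L⁴} (-U₄^{lat}) ≥ c L¹²` for all large `L`. -/
theorem numerator_lower {ρ : ℝ → ℝ} {Δ : ℝ} {S : CorrFamily 3}
    (hρ : ∀ δ ∈ Set.Ioc (0:ℝ) 1, 0 < ρ δ)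
    (hlim : HasPointwiseScalingLimit (criticalCorr 3) ρ S) (hsc : IsScaleCovariant Δ S)
    (hU4 : HasNontrivialU4 S) :
    ∃ c : ℝ, 0 < c ∧ ∀ᶠ L : ℕ in atTop,
      c * (L : ℝ) ^ 12 ≤ ρ (1 / (L : ℝ)) ^ 4 *
        ∑ a ∈ box 3 L, ∑ b ∈ box 3 L, ∑ c ∈ box 3 L, ∑ e ∈ box 3 L,
          -(criticalCorr 3 4 ![a, b, c, e] -
            (criticalCorr 3 2 ![a, b] * criticalCorr 3 2 ![c, e] +
              criticalCorr 3 2 ![a, c] * criticalCorr 3 2 ![b, e] +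
              criticalCorr 3 2 ![a, e] * criticalCorr 3 2 ![b, c])) := by
  classical
  have hd : 3 ≤ 3 := le_rfl
  -- the lattice Ursell function and its sign (Lebowitz)
  set U : (Fin 4 → Site 3) → ℝ := fun w => criticalCorr 3 4 w -
    (criticalCorr 3 2 ![w 0, w 1] * criticalCorr 3 2 ![w 2, w 3] +
      criticalCorr 3 2 ![w 0, w 2] * criticalCorr 3 2 ![w 1, w 3] +
      criticalCorr 3 2 ![w 0, w 3] * criticalCorr 3 2 ![w 1, w 2]) with hUdef
  have hUnonpos : ∀ w, U w ≤ 0 := fun w => criticalUrsellFour_nonpos hd w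
  -- a strictly negative value of `U₄^S`
  obtain ⟨x₀, hx₀, hneg₀⟩ := (hasNontrivialU4_iff_exists_neg_of_hasPointwiseScalingLimit hd hlim).1 hU4
  -- rescale into the cube `|x| ≤ 1/2`
  set R : ℝ := 1 + ∑ j, ∑ k, |x₀ j k| with hR
  have hR1 : 1 ≤ R := by
    have : 0 ≤ ∑ j, ∑ k, |x₀ j k| :=
      Finset.sum_nonneg fun j _ => Finset.sum_nonneg fun k _ => abs_nonneg _
    linarith
  have hRpos : 0 < R := by linarith
  have hxR : ∀ j k, |x₀ j k| ≤ R - 1 := by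
    intro j k
    have h1 : |x₀ j k| ≤ ∑ k', |x₀ j k'| :=
      Finset.single_le_sum (f := fun k' => |x₀ j k'|) (fun _ _ => abs_nonneg _) (Finset.mem_univ k)
    have h2 : ∑ k', |x₀ j k'| ≤ ∑ j', ∑ k', |x₀ j' k'| :=
      Finset.single_le_sum (f := fun j' => ∑ k', |x₀ j' k'|)
        (fun _ _ => Finset.sum_nonneg fun _ _ => abs_nonneg _) (Finset.mem_univ j)
    rw [hR]; linarith
  set c₀ : ℝ := 1 / (2 * R) with hc₀
  have hc₀pos : 0 < c₀ := by positivity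
  set x₁ : Fin 4 → EuclideanSpace ℝ (Fin 3) := fun j => c₀ • x₀ j with hx₁
  have hx₁k : ∀ j k, x₁ j k = c₀ * x₀ j k := fun j k => by
    simp [hx₁, PiLp.smul_apply, smul_eq_mul]
  have hx₁abs : ∀ j k, |x₁ j k| ≤ 1 / 2 := by
    intro j k
    rw [hx₁k, abs_mul, abs_of_pos hc₀pos, hc₀]
    have := hxR j k
    rw [div_mul_eq_mul_div, one_mul, div_le_iff₀ (by positivity)]
    nlinarith
  have hx₁nc : x₁ ∈ NonCoincident 3 4 := by
    rw [mem_nonCoincident]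
    intro i j hij
    have hinj : Function.Injective x₀ := hx₀
    exact hinj (smul_right_injective _ hc₀pos.ne' hij)
  have hneg₁ : limitConnectedFour S x₁ < 0 := by
    rw [hx₁, limitConnectedFour_smul hsc hc₀pos]
    exact mul_neg_of_pos_of_neg (Real.rpow_pos_of_pos hc₀pos _) hneg₀
  -- a compact non-coincident corner box at `x₁` and uniform convergence on it
  obtain ⟨r₀, hr₀pos, hr₀half, hK₀s⟩ := exists_corner_subset_nonCoincident hx₁nc
  have hK₀c := isCompact_corner x₁ r₀
  set F : ℝ → (Fin 4 → EuclideanSpace ℝ (Fin 3)) → ℝ :=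
    fun δ y => ρ δ ^ 4 * U (fun k => latticeApprox δ (y k)) with hF
  have hU : TendstoUniformlyOn F (limitConnectedFour S) (𝓝[>] (0:ℝ))
      {y | ∀ j k, x₁ j k ≤ y j k ∧ y j k ≤ x₁ j k + r₀} :=
    tendstoUniformlyOn_rescaled_criticalUrsellFour hd hlim hK₀c hK₀s
  set ε : ℝ := -limitConnectedFour S x₁ / 4 with hε
  have hεpos : 0 < ε := by rw [hε]; linarith
  have hev := Metric.tendstoUniformlyOn_iff.1 hU ε hεpos
  -- one mesh `δ₀` and the one-sided cell trick
  obtain ⟨δ₀, hδ₀P, hδ₀pos⟩ := (hev.and self_mem_nhdsWithin).exists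
  replace hδ₀pos : 0 < δ₀ := hδ₀pos
  have hgap : ∀ j k, 0 < δ₀ * (1 - Int.fract (x₁ j k / δ₀)) := fun j k =>
    mul_pos hδ₀pos (by linarith [Int.fract_lt_one (x₁ j k / δ₀)])
  have hev_r : ∀ᶠ r in 𝓝[>] (0:ℝ), (∀ j k, r < δ₀ * (1 - Int.fract (x₁ j k / δ₀))) ∧ r ≤ r₀ := by
    refine (Filter.eventually_all.2 fun j => Filter.eventually_all.2 fun k => ?_).and ?_
    · exact mem_nhdsWithin_of_mem_nhds (Iio_mem_nhds (hgap j k))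
    · exact mem_nhdsWithin_of_mem_nhds (Iic_mem_nhds hr₀pos)
  obtain ⟨r₁, ⟨hr₁gap, hr₁r₀⟩, hr₁pos⟩ := (hev_r.and self_mem_nhdsWithin).exists
  replace hr₁pos : 0 < r₁ := hr₁pos
  have hcell : ∀ y : Fin 4 → EuclideanSpace ℝ (Fin 3), (∀ j k, x₁ j k ≤ y j k ∧ y j k ≤ x₁ j k + r₁) →
      ∀ j, latticeApprox δ₀ (y j) = latticeApprox δ₀ (x₁ j) := by
    intro y hy j
    funext k
    simp only [latticeApprox_apply]
    exact floor_div_eq_of_corner hδ₀pos (hy j k).1 (lt_of_le_of_lt (hy j k).2 (by linarith [hr₁gap j k]))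
  have hK₁K₀ : ∀ y : Fin 4 → EuclideanSpace ℝ (Fin 3), (∀ j k, x₁ j k ≤ y j k ∧ y j k ≤ x₁ j k + r₁) →
      y ∈ {y : Fin 4 → EuclideanSpace ℝ (Fin 3) | ∀ j k, x₁ j k ≤ y j k ∧ y j k ≤ x₁ j k + r₀} :=
    fun y hy j k => ⟨(hy j k).1, (hy j k).2.trans (by linarith)⟩
  -- `U₄^S < -2ε` on the small corner box
  have hnegK₁ : ∀ y : Fin 4 → EuclideanSpace ℝ (Fin 3), (∀ j k, x₁ j k ≤ y j k ∧ y j k ≤ x₁ j k + r₁) →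
      limitConnectedFour S y < -2 * ε := by
    intro y hy
    have h1 := hδ₀P y (hK₁K₀ y hy)
    have h2 := hδ₀P x₁ (fun j k => ⟨le_rfl, by linarith⟩)
    have hFF : F δ₀ y = F δ₀ x₁ := by
      simp only [hF]
      rw [show (fun k => latticeApprox δ₀ (y k)) = fun k => latticeApprox δ₀ (x₁ k) from
        funext (hcell y hy)]
    rw [hFF, Real.dist_eq] at h1
    rw [Real.dist_eq] at h2
    have h1' := (abs_sub_lt_iff.1 h1)
    have h2' := (abs_sub_lt_iff.1 h2)
    have hx₁val : limitConnectedFour S x₁ = -4 * ε := by rw [hε]; ring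
    linarith [h1'.1, h1'.2, h2'.1, h2'.2]
  -- along `δ = 1/L`
  have hevL := tendsto_one_div_nat.eventually hev
  refine ⟨ε * (r₁ / 2) ^ 12, by positivity, ?_⟩
  filter_upwards [hevL, eventually_ge_atTop 1, eventually_ge_atTop ⌈2 / r₁⌉₊] with L hL hL1 hL2
  have hLpos : (0 : ℝ) < L := by exact_mod_cast hL1
  have hLposN : 0 < L := hL1
  have hδpos : (0 : ℝ) < 1 / (L : ℝ) := by positivity
  have hδle : 1 / (L : ℝ) ≤ 1 := by
    rw [div_le_one hLpos]; exact_mod_cast hL1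
  have hρpos : 0 < ρ (1 / (L : ℝ)) := hρ _ ⟨hδpos, hδle⟩
  have hLr : 2 / r₁ ≤ (L : ℝ) := le_trans (Nat.le_ceil _) (by exact_mod_cast hL2)
  have hLr1 : 2 ≤ (L : ℝ) * r₁ := by
    rw [div_le_iff₀ hr₁pos] at hLr; linarith
  -- the lattice cubes
  set A : Fin 4 → Finset (Site 3) := fun j =>
    Fintype.piFinset fun k => Finset.Icc ⌈(L : ℝ) * x₁ j k⌉ ⌊(L : ℝ) * (x₁ j k + r₁)⌋ with hA
  have hAbox : ∀ j, A j ⊆ box 3 L := fun j =>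
    latticeCube_subset_box (u := x₁ j) (hx₁abs j) (hr₁r₀.trans hr₀half)
  have hAcard : ∀ j, ((L : ℝ) * r₁ / 2) ^ 3 ≤ (#(A j) : ℝ) := by
    intro j
    refine le_trans ?_ (le_card_latticeCube (u := x₁ j) (by linarith))
    have h0 : 0 ≤ (L : ℝ) * r₁ / 2 := by positivity
    exact pow_le_pow_left₀ h0 (by linarith) 3
  -- the pointwise bound on the lattice cubes
  have hpt : ∀ z : Fin 4 → Site 3, (∀ j, z j ∈ A j) → ε ≤ ρ (1 / (L : ℝ)) ^ 4 * (-U z) := by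
    intro z hz
    set y : Fin 4 → EuclideanSpace ℝ (Fin 3) := fun j => (1 / (L : ℝ)) • siteVec (z j) with hy
    have hyK : ∀ j k, x₁ j k ≤ y j k ∧ y j k ≤ x₁ j k + r₁ := fun j k =>
      div_mem_of_mem_latticeCube (u := x₁ j) hLposN (hz j) k
    have hzy : ∀ j, latticeApprox (1 / (L : ℝ)) (y j) = z j := fun j =>
      latticeApprox_smul_siteVec hδpos (z j)
    have h1 := hL y (hK₁K₀ y hyK)
    have h2 := hnegK₁ y hyK
    have hFy : F (1 / (L : ℝ)) y = ρ (1 / (L : ℝ)) ^ 4 * U z := by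
      simp only [hF]
      rw [show (fun k => latticeApprox (1 / (L : ℝ)) (y k)) = z from funext hzy]
    rw [hFy, Real.dist_eq] at h1
    have h1' := abs_sub_lt_iff.1 h1
    nlinarith [h1'.1, h1'.2]
  -- sum over the product of the cubes
  have hsumA : ε * (∏ j, (#(A j) : ℝ)) ≤
      ρ (1 / (L : ℝ)) ^ 4 * ∑ a ∈ A 0, ∑ b ∈ A 1, ∑ c ∈ A 2, ∑ e ∈ A 3, -U ![a, b, c, e] := by
    rw [Finset.mul_sum]
    simp_rw [Finset.mul_sum]
    have h : ∀ a ∈ A 0, ∀ b ∈ A 1, ∀ c ∈ A 2, ∀ e ∈ A 3,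
        ε ≤ ρ (1 / (L : ℝ)) ^ 4 * -U ![a, b, c, e] := by
      intro a ha b hb c hc e he
      refine hpt ![a, b, c, e] fun j => ?_
      fin_cases j <;> simpa
    calc ε * ∏ j, (#(A j) : ℝ) = ∑ _a ∈ A 0, ∑ _b ∈ A 1, ∑ _c ∈ A 2, ∑ _e ∈ A 3, ε := by
          simp only [Finset.sum_const, nsmul_eq_mul, Fin.prod_univ_four]
          ring
      _ ≤ ∑ a ∈ A 0, ∑ b ∈ A 1, ∑ c ∈ A 2, ∑ e ∈ A 3, ρ (1 / (L : ℝ)) ^ 4 * -U ![a, b, c, e] :=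
          Finset.sum_le_sum fun a ha => Finset.sum_le_sum fun b hb => Finset.sum_le_sum fun c hc =>
            Finset.sum_le_sum fun e he => h a ha b hb c hc e he
  have hsub : ∑ a ∈ A 0, ∑ b ∈ A 1, ∑ c ∈ A 2, ∑ e ∈ A 3, -U ![a, b, c, e] ≤
      ∑ a ∈ box 3 L, ∑ b ∈ box 3 L, ∑ c ∈ box 3 L, ∑ e ∈ box 3 L, -U ![a, b, c, e] :=
    sum4_le_sum4 (f := fun a b c e => -U ![a, b, c, e]) (fun a b c e => by
      have := hUnonpos ![a, b, c, e]; linarith) (hAbox 0) (hAbox 1) (hAbox 2) (hAbox 3)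
  have hprod : ((L : ℝ) * r₁ / 2) ^ 12 ≤ ∏ j, (#(A j) : ℝ) := by
    calc ((L : ℝ) * r₁ / 2) ^ 12 = ∏ _j : Fin 4, ((L : ℝ) * r₁ / 2) ^ 3 := by
          rw [Finset.prod_const, Finset.card_univ, Fintype.card_fin]; ring
      _ ≤ ∏ j, (#(A j) : ℝ) := Finset.prod_le_prod (fun j _ => by positivity) fun j _ => hAcard j
  have hρ4 : 0 ≤ ρ (1 / (L : ℝ)) ^ 4 := by positivity
  have key : ε * (r₁ / 2) ^ 12 * (L : ℝ) ^ 12 ≤ ρ (1 / (L : ℝ)) ^ 4 *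
      ∑ a ∈ box 3 L, ∑ b ∈ box 3 L, ∑ c ∈ box 3 L, ∑ e ∈ box 3 L, -U ![a, b, c, e] := by
    calc ε * (r₁ / 2) ^ 12 * (L : ℝ) ^ 12 = ε * ((L : ℝ) * r₁ / 2) ^ 12 := by ring
      _ ≤ ε * ∏ j, (#(A j) : ℝ) := mul_le_mul_of_nonneg_left hprod hεpos.le
      _ ≤ ρ (1 / (L : ℝ)) ^ 4 * ∑ a ∈ A 0, ∑ b ∈ A 1, ∑ c ∈ A 2, ∑ e ∈ A 3, -U ![a, b, c, e] :=
          hsumA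
      _ ≤ ρ (1 / (L : ℝ)) ^ 4 *
            ∑ a ∈ box 3 L, ∑ b ∈ box 3 L, ∑ c ∈ box 3 L, ∑ e ∈ box 3 L, -U ![a, b, c, e] :=
          mul_le_mul_of_nonneg_left hsub hρ4
  exact key

end Summit.CriticalPhenomena.Ising3DConformalLimit.LeeYangGapSummitDescent

end
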